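import Literature.NumberTheory.Automorphic.IntegratedOperatorStar
import Literature.NumberTheory.Automorphic.SupercuspidalTwoPlaceNonvanishing
import Mathlib.Data.Finset.NoncommProd
import HarnessLib

/-!
# Products of commuting local operators do not vanish on an irreducible representation:
# `R_{v₁}(ξ₁) ⋯ R_{v_k}(ξ_k)|_π ≠ 0` as soon as each `R_{v_i}(ξ_i)|_π ≠ 0`
(Gelbart, *Automorphic forms on adele groups* (1975), §10, pp. 151–153: for a cuspidal `π`
with `π_v ≅ σ_v` at the places `v ∈ S`, the operator `R(ξ_S)`, `ξ_S = ⊗_{v ∈ S} f_v`, cuts out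
the non-zero space `{⊗_{v ∈ S} u_v} ⊗ {⊗_{v ∉ S} V_v}` of `π`; Jacquet–Langlands, LNM 114 (1970),
§16, p. 503)

Topic `NumberTheory/Automorphic`; theorems only (no definition, no named fact, no instance).

In Gelbart's proof of Thm. 10.5 the test functions are `Φ = ξ_S ⊗ f` with a **fixed** function
`ξ_S = ⊗_{v ∈ S} ξ_v` at the finite set `S = Ram(D)` of places (normalised matrix coefficients,
(10.11)), and the first thing to know about a cuspidal constituent `π` with the prescribed local
components is that `R(ξ_S)` does not annihilate it. With the tensor product theorem this is read
off from `π ≅ ⊗' π_v`; the tree has no tensor product theorem, and this file proves the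
non-vanishing **place by place from irreducibility alone**:

* `exists_apply_centralizer_apply_ne_zero_of_isTopIrreducible` (**engine**): `σ` a topologically
  irreducible representation of `G` on a normed space `H`, `ι : L →* G` with
  `G = ι(L) · C_G(ι(L))`, `P : H → H` a non-zero bounded operator commuting with `σ(ι L)` and
  `T : H → H'` non-zero bounded. Then `T (σ(c) (P x)) ≠ 0` for some `c ∈ C_G(ι(L))` and some `x`
  (the span of the `σ(c) P x` is `G`-invariant and non-zero, hence dense).
* `comp_ne_zero_of_isTopIrreducible`: if moreover `A : H → H` is non-zero, bounded and commutes
  with `σ(c)` for every `c ∈ C_G(ι(L))`, then **`A ∘ P ≠ 0`** (`A σ(c) P x = σ(c) A P x ≠ 0`).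
* `noncommProd_ne_zero_of_isTopIrreducible`: for a family of homomorphisms `ι_v : L_v →* G`
  (`v ∈ 𝓥`) with `G = ι_v(L_v) · C_G(ι_v(L_v))` for each `v` and `ι_v(L_v)`, `ι_w(L_w)` commuting
  for `v ≠ w`, and pairwise commuting bounded operators `A_v` with `A_v` commuting with
  `σ(C_G(ι_v L_v))`: **if `A_v ≠ 0` for all `v` in a non-empty finite `S`, then
  `∏_{v ∈ S} A_v ≠ 0`** (induction on `S`; the partial product commutes with `σ(ι_a L_a)` for a
  new place `a`).
* The case of integrated local operators: for `σ` unitary and strongly continuous along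
  `ι : L →* G`, a measure `μ` on `L` finite on compact sets and `ξ ∈ C_c(L)`, the operator
  `σ|_ι(ξ) = ∫_L ξ(l) σ(ι l) dμ` commutes with every bounded operator commuting with all `σ(ι l)`
  (`integratedOperator_restrict_comm_of_forall_comm`), in particular with `σ(c)`,
  `c ∈ C_G(ι(L))`, and with `σ|_{ι'}(ξ')` for a homomorphism `ι'` whose image commutes with
  `ι(L)` (`integratedOperator_restrict_comm_of_commute`).
* `GLn.exists_eq_toAdelic_mul_centralizer` — `GL_n(𝔸_K) = ι_v(GL_n(K_v)) · C(ι_v(GL_n(K_v)))`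
  (`g = ι_v(g_v) · (ι_v(g_v)⁻¹ g)`, the second factor being trivial at `v`).
* `GLn.noncommProd_integratedOperator_toAdelic_ne_zero` — **for a topologically irreducible
  unitary representation `σ` of `GL_n(𝔸_K)`, strongly continuous along the local embeddings, a
  non-empty finite set `S` of finite places, measures `μ_v` finite on compact sets and
  `ξ_v ∈ C_c(GL_n(K_v))` with `σ|_{ι_v}(ξ_v) ≠ 0` for every `v ∈ S`:
  `∏_{v ∈ S} σ|_{ι_v}(ξ_v) ≠ 0`.** For a cuspidal (or any irreducible) constituent `π` with a
  local component `ρ_v` at `v` through an injective intertwiner `f_v`, `σ|_{ι_v}(ξ_v) (f_v x) ≠ 0`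
  as soon as `∫ ξ_v ũ(ρ_v(g) x) ≠ 0` for some linear form `ũ`
  (`integratedOperator_restrict_apply_ne_zero`, `IntegratedOperatorLocalNonvanishing`), so the
  hypothesis is a statement about `ρ_v(ξ_v)` alone — e.g. `⟪ρ_v(ξ_v) u, u⟫ = d ∫ |⟪ρ_v(g)u, u⟫|² > 0`
  for Gelbart's `ξ_v = d · conj ⟪ρ_v(g) u, u⟫` (cut off to a compact set).

Part of the inline (D-0026) decomposition of
`Literature.NumberTheory.Automorphic.jacquetLanglands_transfer_surjective` (Gelbart Thm. 10.5
(ii)): the non-vanishing on `π` of the fixed ramified factor `R(ξ_S)` of the matched test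
functions `ξ_S ⊗ f`, for `S` of any (finite) size.

## References

* S. Gelbart, *Automorphic forms on adele groups*, Ann. of Math. Studies 83 (1975), §10,
  pp. 151–153, (10.11)–(10.13) [Gelbart1975].
* H. Jacquet, R. P. Langlands, *Automorphic forms on `GL(2)`*, LNM 114 (1970), §16, p. 503
  [JacquetLanglands1970].
-/

noncomputable section

open MeasureTheory Measure Set Filter Topology CompactlySupported NumberField IsDedekindDomain
open scoped Pointwise

namespace Literature.NumberTheory.Automorphic

/-! ### The engine: an equivariant operator and an arbitrary one never compose to zero through
the centraliser -/

section Engine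

variable {G L : Type*} [Group G] [Group L]
  {H : Type*} [NormedAddCommGroup H] [NormedSpace ℂ H]
  {H' : Type*} [NormedAddCommGroup H'] [NormedSpace ℂ H']

/-- **Engine.** Let `σ` be a topologically irreducible representation of `G` on the normed space
`H`, `ι : L →* G` a homomorphism with `G = ι(L) · C_G(ι(L))`, `P : H → H` a non-zero bounded
operator commuting with every `σ(ι l)`, and `T : H → H'` a non-zero bounded linear map. Then
`T (σ(c) (P x)) ≠ 0` for some `c` centralising `ι(L)` and some `x`: the span of the vectors
`σ(c) (P x)` is `G`-invariant (`σ(ι(l) c₀) σ(c) P x = σ(c₀ c) P (σ(ι l) x)`) and non-zero, so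
its closure is `H`, on which `T ≠ 0` (Gelbart (1975), p. 152). [folklore] -/
theorem exists_apply_centralizer_apply_ne_zero_of_isTopIrreducible
    (σ : ContRepresentation ℂ G H) (hσ : σ.IsTopIrreducible) (ι : L →* G)
    (hgen : ∀ g : G, ∃ (l : L) (c : G), c ∈ Subgroup.centralizer (Set.range ι) ∧ g = ι l * c)
    (P : H →L[ℂ] H) (hP0 : P ≠ 0) (hP : ∀ l : L, P ∘L σ (ι l) = σ (ι l) ∘L P)
    (T : H →L[ℂ] H') (hT0 : T ≠ 0) :
    ∃ c ∈ Subgroup.centralizer (Set.range ι), ∃ x : H, T (σ c (P x)) ≠ 0 := by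
  by_contra hcon
  push Not at hcon
  apply hT0
  -- the span of the translates `σ(c) (P x)`, `c` centralising `ι(L)`
  set S : Set H := {y | ∃ c ∈ Subgroup.centralizer (Set.range ι), ∃ x : H, y = σ c (P x)} with hS
  set M : Submodule ℂ H := Submodule.span ℂ S with hM
  -- it is `G`-invariant
  have hMG : ∀ (g : G) (y : H), y ∈ M → σ g y ∈ M := by
    intro g y hy
    obtain ⟨l, c₀, hc₀, rfl⟩ := hgen g
    have hle : M ≤ M.comap ((σ (ι l * c₀) : H →L[ℂ] H) : H →ₗ[ℂ] H) := by
      rw [hM, Submodule.span_le]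
      rintro _ ⟨c, hc, x, rfl⟩
      change σ (ι l * c₀) (σ c (P x)) ∈ Submodule.span ℂ S
      refine Submodule.subset_span ⟨c₀ * c, Subgroup.mul_mem _ hc₀ hc, σ (ι l) x, ?_⟩
      have hcomm : ι l * (c₀ * c) = c₀ * c * ι l :=
        (Subgroup.mem_centralizer_iff.1 (Subgroup.mul_mem _ hc₀ hc)) (ι l) ⟨l, rfl⟩
      have hPl : P (σ (ι l) x) = σ (ι l) (P x) := by
        rw [← ContinuousLinearMap.comp_apply, hP l, ContinuousLinearMap.comp_apply]
      rw [← mul_apply_eq_comp (σ (ι l * c₀)) (σ c), ← map_mul, mul_assoc, hcomm,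
        map_mul σ (c₀ * c) (ι l), mul_apply_eq_comp, hPl]
    exact hle hy
  -- its closure is a closed subrepresentation
  let W : ContRepresentation.ClosedSubrep σ :=
    { toSubmodule := M.topologicalClosure
      apply_mem_toSubmodule := fun g y hy => by
        have hmaps : Set.MapsTo (σ g) (M : Set H) (M : Set H) := fun z hz => hMG g z hz
        have hcl := hmaps.closure (σ g).continuous
        rw [← Submodule.topologicalClosure_coe] at hcl
        exact hcl hy
      isClosed' := Submodule.isClosed_topologicalClosure _ }
  -- `T` vanishes on `W`
  have hTM : M ≤ LinearMap.ker (T : H →ₗ[ℂ] H') := by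
    rw [hM, Submodule.span_le]
    rintro _ ⟨c, hc, x, rfl⟩
    exact hcon c hc x
  have hTW : W.toSubmodule ≤ LinearMap.ker (T : H →ₗ[ℂ] H') :=
    Submodule.topologicalClosure_minimal _ hTM (T.isClosed_ker)
  -- `W` contains `P(H) ≠ 0`, hence `W = ⊤`
  obtain ⟨x₁, hx₁⟩ : ∃ x : H, P x ≠ 0 := by
    by_contra h
    push Not at h
    exact hP0 (ContinuousLinearMap.ext h)
  have hPW : P x₁ ∈ W := by
    change P x₁ ∈ M.topologicalClosure
    refine Submodule.le_topologicalClosure _ (Submodule.subset_span ⟨1, Subgroup.one_mem _, x₁, ?_⟩)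
    rw [map_one, one_apply_eq_self]
  have hWtop : W = ⊤ := by
    rcases ((ContRepresentation.isTopIrreducible_iff σ).1 hσ).2 W with h | h
    · exfalso
      rw [h, ContRepresentation.ClosedSubrep.mem_bot] at hPW
      exact hx₁ hPW
    · exact h
  refine ContinuousLinearMap.ext fun y => ?_
  have hy : y ∈ W := by
    rw [hWtop]
    exact ContRepresentation.ClosedSubrep.mem_top y
  exact hTW hy

/-- **An operator commuting with the centraliser of `ι(L)` and an operator commuting with `ι(L)`
never compose to zero on an irreducible representation** (unless one of them is zero): with `σ`,
`ι`, `P` as in `exists_apply_centralizer_apply_ne_zero_of_isTopIrreducible` and `A : H → H`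
non-zero, bounded, with `A σ(c) = σ(c) A` for all `c ∈ C_G(ι(L))`, one has `A ∘ P ≠ 0`. Indeed
`A (σ(c) (P x)) ≠ 0` for some such `c` and some `x`, and `A σ(c) P x = σ(c) (A P x)`. This is the
mechanism by which, in Gelbart (1975), pp. 151–153, the operators at the different places of `S`
cut out a *non-zero* subspace of each relevant constituent. [folklore] -/
theorem comp_ne_zero_of_isTopIrreducible
    (σ : ContRepresentation ℂ G H) (hσ : σ.IsTopIrreducible) (ι : L →* G)
    (hgen : ∀ g : G, ∃ (l : L) (c : G), c ∈ Subgroup.centralizer (Set.range ι) ∧ g = ι l * c)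
    (A : H →L[ℂ] H) (hA0 : A ≠ 0)
    (hA : ∀ c ∈ Subgroup.centralizer (Set.range ι), A ∘L σ c = σ c ∘L A)
    (P : H →L[ℂ] H) (hP0 : P ≠ 0) (hP : ∀ l : L, P ∘L σ (ι l) = σ (ι l) ∘L P) :
    A ∘L P ≠ 0 := by
  obtain ⟨c, hc, x, hx⟩ :=
    exists_apply_centralizer_apply_ne_zero_of_isTopIrreducible σ hσ ι hgen P hP0 hP A hA0
  intro h
  apply hx
  rw [← ContinuousLinearMap.comp_apply, hA c hc, ContinuousLinearMap.comp_apply,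
    ← ContinuousLinearMap.comp_apply A P, h, zero_apply, map_zero]

end Engine

/-! ### Finite families of places -/

section Family

variable {G : Type*} [Group G] {𝓥 : Type*} {L : 𝓥 → Type*} [∀ v, Group (L v)]
  {H : Type*} [NormedAddCommGroup H] [NormedSpace ℂ H]

/-- **`∏_{v ∈ S} A_v ≠ 0` on an irreducible representation, if every `A_v ≠ 0`.** Let `σ` be a
topologically irreducible representation of `G` on `H` and `ι_v : L_v →* G` (`v ∈ 𝓥`)
homomorphisms with `G = ι_v(L_v) · C_G(ι_v(L_v))` for each `v` (`hgen`) and `ι_v(l)`, `ι_w(m)`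
commuting for `v ≠ w` (`hcomm`; e.g. the local embeddings `GL_n(K_v) ↪ GL_n(𝔸_K)`). Let
`A_v : H → H` be pairwise commuting bounded operators such that `A_v` commutes with `σ(c)` for
every `c ∈ C_G(ι_v(L_v))` (`hAc`; e.g. `A_v = ∫ ξ_v(l) σ(ι_v l) dl`). If `A_v ≠ 0` for every `v`
in a non-empty finite set `S`, then `∏_{v ∈ S} A_v ≠ 0`. Induction on `S`: for `S = {a} ∪ T`,
`∏_{T} A_w` commutes with `σ(ι_a l)` (each `A_w` does, `ι_a(l)` centralising `ι_w(L_w)`), and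
`comp_ne_zero_of_isTopIrreducible` applies to `A_a` and `∏_T A_w` (Gelbart (1975),
pp. 151–153: the space `M ∩ π ⊇ {⊗_{v ∈ S} u_v} ⊗ V^S` is non-zero). [folklore] -/
theorem noncommProd_ne_zero_of_isTopIrreducible
    (σ : ContRepresentation ℂ G H) (hσ : σ.IsTopIrreducible) (ι : ∀ v : 𝓥, L v →* G)
    (hgen : ∀ (v : 𝓥) (g : G), ∃ (l : L v) (c : G),
      c ∈ Subgroup.centralizer (Set.range (ι v)) ∧ g = ι v l * c)
    (hcomm : ∀ (v w : 𝓥), v ≠ w → ∀ (l : L v) (m : L w), ι v l * ι w m = ι w m * ι v l)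
    (A : 𝓥 → (H →L[ℂ] H))
    (hAc : ∀ (v : 𝓥), ∀ c ∈ Subgroup.centralizer (Set.range (ι v)), A v ∘L σ c = σ c ∘L A v)
    (S : Finset 𝓥) (comm : (S : Set 𝓥).Pairwise fun v w => Commute (A v) (A w))
    (hS : S.Nonempty) (hA0 : ∀ v ∈ S, A v ≠ 0) :
    S.noncommProd A comm ≠ 0 := by
  classical
  -- `A_w` commutes with `σ(ι_v l)` for `w ≠ v`
  have hAι : ∀ (v w : 𝓥), v ≠ w → ∀ l : L v, A w ∘L σ (ι v l) = σ (ι v l) ∘L A w := by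
    intro v w hvw l
    refine hAc w (ι v l) ?_
    rw [Subgroup.mem_centralizer_iff]
    rintro _ ⟨m, rfl⟩
    exact (hcomm v w hvw l m).symm
  induction S using Finset.induction_on with
  | empty => exact absurd hS (Finset.not_nonempty_empty)
  | @insert a T haT ih =>
    rw [Finset.noncommProd_insert_of_notMem _ _ _ _ haT]
    rcases T.eq_empty_or_nonempty with hT | hT
    · subst hT
      rw [Finset.noncommProd_empty, mul_one]
      exact hA0 a (Finset.mem_insert_self a _)
    · have hP0 : T.noncommProd A (comm.mono fun _ => Finset.mem_insert_of_mem) ≠ 0 :=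
        ih _ hT (fun v hv => hA0 v (Finset.mem_insert_of_mem hv))
      have hP : ∀ l : L a, T.noncommProd A (comm.mono fun _ => Finset.mem_insert_of_mem) ∘L
          σ (ι a l) = σ (ι a l) ∘L T.noncommProd A (comm.mono fun _ => Finset.mem_insert_of_mem) := by
        intro l
        have hc : Commute (σ (ι a l)) (T.noncommProd A (comm.mono fun _ => Finset.mem_insert_of_mem)) := by
          refine Finset.noncommProd_commute T A _ (σ (ι a l)) fun w hw => ?_
          have hwa : a ≠ w := fun h => haT (h ▸ hw)
          exact (hAι a w hwa l).symm
        exact hc.eq.symm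
      exact comp_ne_zero_of_isTopIrreducible σ hσ (ι a) (hgen a) (A a)
        (hA0 a (Finset.mem_insert_self a _)) (hAc a) _ hP0 hP

end Family

/-! ### Integrated local operators commute with what commutes with the local group -/

section Integrated

variable {G L : Type*} [Group G] [Group L] [TopologicalSpace L] [MeasurableSpace L] [BorelSpace L]
  {H : Type*} [NormedAddCommGroup H] [InnerProductSpace ℂ H] [CompleteSpace H]

/-- **`σ|_ι(ξ)` commutes with every bounded operator commuting with the `σ(ι l)`**: for
`B : H → H` bounded with `B σ(ι l) = σ(ι l) B` for all `l`,
`B ∘ ∫ ξ(l) σ(ι l) dμ = (∫ ξ(l) σ(ι l) dμ) ∘ B` (Bochner integrals commute with bounded operators).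
[folklore] -/
theorem integratedOperator_restrict_comm_of_forall_comm {σ : ContRepresentation ℂ G H} (ι : L →* G)
    (hu : (σ.restrict ι).IsUnitary) (hc : (σ.restrict ι).IsStronglyContinuous)
    (μ : Measure L) [IsFiniteMeasureOnCompacts μ] (ξ : C_c(L, ℂ))
    (B : H →L[ℂ] H) (hB : ∀ l : L, B ∘L σ (ι l) = σ (ι l) ∘L B) :
    B ∘L (σ.restrict ι).integratedOperator hu hc μ ξ = (σ.restrict ι).integratedOperator hu hc μ ξ ∘L B := by
  ext v
  rw [ContinuousLinearMap.comp_apply, ContinuousLinearMap.comp_apply,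
    ContRepresentation.integratedOperator_apply, ContRepresentation.integratedOperator_apply,
    ← ContinuousLinearMap.integral_comp_comm B (ContRepresentation.integrable_smul_apply hc μ ξ v)]
  refine integral_congr_ae (Eventually.of_forall fun l => ?_)
  change B (ξ l • σ (ι l) v) = ξ l • σ (ι l) (B v)
  rw [ContinuousLinearMap.map_smul, ← ContinuousLinearMap.comp_apply, hB l,
    ContinuousLinearMap.comp_apply]

/-- In particular `σ|_ι(ξ)` commutes with `σ(c)` for `c` centralising `ι(L)`. [folklore] -/
theorem integratedOperator_restrict_comm_of_mem_centralizer {σ : ContRepresentation ℂ G H}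
    (ι : L →* G) (hu : (σ.restrict ι).IsUnitary) (hc : (σ.restrict ι).IsStronglyContinuous)
    (μ : Measure L) [IsFiniteMeasureOnCompacts μ] (ξ : C_c(L, ℂ))
    {c : G} (hcz : c ∈ Subgroup.centralizer (Set.range ι)) :
    (σ.restrict ι).integratedOperator hu hc μ ξ ∘L σ c = σ c ∘L (σ.restrict ι).integratedOperator hu hc μ ξ := by
  refine (integratedOperator_restrict_comm_of_forall_comm ι hu hc μ ξ (σ c) fun l => ?_).symm
  have h : ι l * c = c * ι l := (Subgroup.mem_centralizer_iff.1 hcz) (ι l) ⟨l, rfl⟩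
  change σ c * σ (ι l) = σ (ι l) * σ c
  rw [← map_mul, ← map_mul, h]

variable {L' : Type*} [Group L'] [TopologicalSpace L'] [MeasurableSpace L'] [BorelSpace L']

/-- **Integrated operators along commuting homomorphisms commute**: if `ι(l)` and `ι'(l')`
commute for all `l`, `l'` (e.g. the embeddings of `GL_n(K_v)` and `GL_n(K_w)`, `v ≠ w`), then
`σ|_ι(ξ) ∘ σ|_{ι'}(ξ') = σ|_{ι'}(ξ') ∘ σ|_ι(ξ)`. [folklore] -/
theorem integratedOperator_restrict_comm_of_commute {σ : ContRepresentation ℂ G H}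
    (ι : L →* G) (ι' : L' →* G) (hιι' : ∀ (l : L) (l' : L'), ι l * ι' l' = ι' l' * ι l)
    (hu : (σ.restrict ι).IsUnitary) (hc : (σ.restrict ι).IsStronglyContinuous)
    (μ : Measure L) [IsFiniteMeasureOnCompacts μ] (ξ : C_c(L, ℂ))
    (hu' : (σ.restrict ι').IsUnitary) (hc' : (σ.restrict ι').IsStronglyContinuous)
    (μ' : Measure L') [IsFiniteMeasureOnCompacts μ'] (ξ' : C_c(L', ℂ)) :
    (σ.restrict ι).integratedOperator hu hc μ ξ ∘L (σ.restrict ι').integratedOperator hu' hc' μ' ξ' =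
      (σ.restrict ι').integratedOperator hu' hc' μ' ξ' ∘L (σ.restrict ι).integratedOperator hu hc μ ξ := by
  refine integratedOperator_restrict_comm_of_forall_comm ι' hu' hc' μ' ξ' _ fun l' => ?_
  refine integratedOperator_restrict_comm_of_mem_centralizer ι hu hc μ ξ ?_
  rw [Subgroup.mem_centralizer_iff]
  rintro _ ⟨l, rfl⟩
  exact hιι' l l'

end Integrated

/-! ### `GL_n(𝔸_K)`: the local embeddings -/

section GLn

variable {n : ℕ} {K : Type} [Field K] [NumberField K]

/-- **`GL_n(𝔸_K) = ι_v(GL_n(K_v)) · C(ι_v(GL_n(K_v)))`**: `g = ι_v(g_v) · (ι_v(g_v)⁻¹ g)`, the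
second factor being trivial at `v` and hence commuting with `ι_v(GL_n(K_v))`
(`GLn.toAdelic_mul_eq_mul_toAdelic`; Bump (1997), §3.3). [folklore] -/
theorem GLn.exists_eq_toAdelic_mul_centralizer (v : HeightOneSpectrum (𝓞 K))
    (g : (AdelicGroupData.gl n K).Adelic) :
    ∃ (l : GL (Fin n) (v.adicCompletion K)) (c : (AdelicGroupData.gl n K).Adelic),
      c ∈ Subgroup.centralizer (Set.range (GLn.toAdelic n K v)) ∧ g = GLn.toAdelic n K v l * c := by
  refine ⟨GLn.toLocalAt n K v g, (GLn.toAdelic n K v (GLn.toLocalAt n K v g))⁻¹ * g, ?_,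
    (mul_inv_cancel_left _ _).symm⟩
  rw [Subgroup.mem_centralizer_iff]
  rintro _ ⟨t, rfl⟩
  refine GLn.toAdelic_mul_eq_mul_toAdelic ?_ t
  rw [map_mul, map_inv, GLn.toLocal_toAdelic, inv_mul_cancel]

variable [∀ v : HeightOneSpectrum (𝓞 K), MeasurableSpace (GL (Fin n) (v.adicCompletion K))]
  [∀ v : HeightOneSpectrum (𝓞 K), BorelSpace (GL (Fin n) (v.adicCompletion K))]
  {H : Type*} [NormedAddCommGroup H] [InnerProductSpace ℂ H] [CompleteSpace H]

/-- The local integrated operators `σ|_{ι_v}(ξ_v)` and `σ|_{ι_w}(ξ_w)` at two places `v ≠ w`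
commute (`GLn.toAdelic_comm_of_ne`). [folklore] -/
theorem GLn.commute_integratedOperator_toAdelic (σ : ContRepresentation ℂ (AdelicGroupData.gl n K).Adelic H)
    (hu : ∀ v, (σ.restrict (GLn.toAdelic n K v)).IsUnitary)
    (hc : ∀ v, (σ.restrict (GLn.toAdelic n K v)).IsStronglyContinuous)
    (μ : ∀ v : HeightOneSpectrum (𝓞 K), Measure (GL (Fin n) (v.adicCompletion K)))
    [∀ v, IsFiniteMeasureOnCompacts (μ v)]
    (ξ : ∀ v : HeightOneSpectrum (𝓞 K), C_c(GL (Fin n) (v.adicCompletion K), ℂ))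
    {v w : HeightOneSpectrum (𝓞 K)} (hvw : v ≠ w) :
    Commute ((σ.restrict (GLn.toAdelic n K v)).integratedOperator (hu v) (hc v) (μ v) (ξ v))
      ((σ.restrict (GLn.toAdelic n K w)).integratedOperator (hu w) (hc w) (μ w) (ξ w)) :=
  integratedOperator_restrict_comm_of_commute (GLn.toAdelic n K v) (GLn.toAdelic n K w)
    (fun l l' => GLn.toAdelic_comm_of_ne hvw l l') (hu v) (hc v) (μ v) (ξ v) (hu w) (hc w) (μ w) (ξ w)

/-- Hence the family `v ↦ σ|_{ι_v}(ξ_v)` commutes pairwise on any set of places. [folklore] -/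
theorem GLn.pairwise_commute_integratedOperator_toAdelic
    (σ : ContRepresentation ℂ (AdelicGroupData.gl n K).Adelic H)
    (hu : ∀ v, (σ.restrict (GLn.toAdelic n K v)).IsUnitary)
    (hc : ∀ v, (σ.restrict (GLn.toAdelic n K v)).IsStronglyContinuous)
    (μ : ∀ v : HeightOneSpectrum (𝓞 K), Measure (GL (Fin n) (v.adicCompletion K)))
    [∀ v, IsFiniteMeasureOnCompacts (μ v)]
    (ξ : ∀ v : HeightOneSpectrum (𝓞 K), C_c(GL (Fin n) (v.adicCompletion K), ℂ))
    (S : Set (HeightOneSpectrum (𝓞 K))) :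
    S.Pairwise fun v w => Commute ((σ.restrict (GLn.toAdelic n K v)).integratedOperator (hu v) (hc v) (μ v) (ξ v))
      ((σ.restrict (GLn.toAdelic n K w)).integratedOperator (hu w) (hc w) (μ w) (ξ w)) :=
  fun _ _ _ _ hvw => GLn.commute_integratedOperator_toAdelic σ hu hc μ ξ hvw

/-- **`∏_{v ∈ S} σ|_{ι_v}(ξ_v) ≠ 0` on an irreducible representation of `GL_n(𝔸_K)` if each factor
is non-zero** (Gelbart (1975), pp. 151–153: the fixed ramified factor `R(ξ_S)`,
`ξ_S = ⊗_{v ∈ S} ξ_v`, of the test functions `ξ_S ⊗ f` does not annihilate a constituent with the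
prescribed local components). Data: `σ` a topologically irreducible representation of
`GL_n(𝔸_K)` on a Hilbert space, unitary and strongly continuous along every local embedding
`ι_v : GL_n(K_v) → GL_n(𝔸_K)`; measures `μ_v` finite on compact sets; `ξ_v ∈ C_c(GL_n(K_v))`; a
non-empty finite set `S` of finite places with `σ|_{ι_v}(ξ_v) ≠ 0` for all `v ∈ S` (for a
constituent with local component `ρ_v` at `v` through an injective intertwiner `f_v` this holds as
soon as `∫ ξ_v ũ(ρ_v(g) x) dμ_v ≠ 0` for some `x`, `ũ`: `integratedOperator_restrict_apply_ne_zero`).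
Conclusion: the product `∏_{v ∈ S} σ|_{ι_v}(ξ_v)` (in any order, `Finset.noncommProd`; the
factors commute, `GLn.pairwise_commute_integratedOperator_toAdelic`) is non-zero.
[cite: Gelbart1975, §10 pp. 151–153] -/
theorem GLn.noncommProd_integratedOperator_toAdelic_ne_zero
    (σ : ContRepresentation ℂ (AdelicGroupData.gl n K).Adelic H) (hσ : σ.IsTopIrreducible)
    (hu : ∀ v, (σ.restrict (GLn.toAdelic n K v)).IsUnitary)
    (hc : ∀ v, (σ.restrict (GLn.toAdelic n K v)).IsStronglyContinuous)
    (μ : ∀ v : HeightOneSpectrum (𝓞 K), Measure (GL (Fin n) (v.adicCompletion K)))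
    [∀ v, IsFiniteMeasureOnCompacts (μ v)]
    (ξ : ∀ v : HeightOneSpectrum (𝓞 K), C_c(GL (Fin n) (v.adicCompletion K), ℂ))
    (S : Finset (HeightOneSpectrum (𝓞 K))) (hS : S.Nonempty)
    (comm : (S : Set (HeightOneSpectrum (𝓞 K))).Pairwise fun v w =>
      Commute ((σ.restrict (GLn.toAdelic n K v)).integratedOperator (hu v) (hc v) (μ v) (ξ v))
        ((σ.restrict (GLn.toAdelic n K w)).integratedOperator (hu w) (hc w) (μ w) (ξ w)))
    (h0 : ∀ v ∈ S, (σ.restrict (GLn.toAdelic n K v)).integratedOperator (hu v) (hc v) (μ v) (ξ v) ≠ 0) :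
    S.noncommProd (fun v => (σ.restrict (GLn.toAdelic n K v)).integratedOperator (hu v) (hc v) (μ v) (ξ v))
      comm ≠ 0 :=
  noncommProd_ne_zero_of_isTopIrreducible σ hσ (fun v => GLn.toAdelic n K v)
    (fun v g => GLn.exists_eq_toAdelic_mul_centralizer v g)
    (fun _ _ hvw l m => GLn.toAdelic_comm_of_ne hvw l m) _
    (fun v _ hcz => integratedOperator_restrict_comm_of_mem_centralizer (GLn.toAdelic n K v) (hu v) (hc v)
      (μ v) (ξ v) hcz)
    S comm hS h0

/-- The same with a witness: **some vector survives all the local operators**,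
`(∏_{v ∈ S} σ|_{ι_v}(ξ_v)) y ≠ 0` for some `y`. [cite: Gelbart1975, §10 pp. 151–153] -/
theorem GLn.exists_noncommProd_integratedOperator_toAdelic_apply_ne_zero
    (σ : ContRepresentation ℂ (AdelicGroupData.gl n K).Adelic H) (hσ : σ.IsTopIrreducible)
    (hu : ∀ v, (σ.restrict (GLn.toAdelic n K v)).IsUnitary)
    (hc : ∀ v, (σ.restrict (GLn.toAdelic n K v)).IsStronglyContinuous)
    (μ : ∀ v : HeightOneSpectrum (𝓞 K), Measure (GL (Fin n) (v.adicCompletion K)))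
    [∀ v, IsFiniteMeasureOnCompacts (μ v)]
    (ξ : ∀ v : HeightOneSpectrum (𝓞 K), C_c(GL (Fin n) (v.adicCompletion K), ℂ))
    (S : Finset (HeightOneSpectrum (𝓞 K))) (hS : S.Nonempty)
    (comm : (S : Set (HeightOneSpectrum (𝓞 K))).Pairwise fun v w =>
      Commute ((σ.restrict (GLn.toAdelic n K v)).integratedOperator (hu v) (hc v) (μ v) (ξ v))
        ((σ.restrict (GLn.toAdelic n K w)).integratedOperator (hu w) (hc w) (μ w) (ξ w)))
    (h0 : ∀ v ∈ S, (σ.restrict (GLn.toAdelic n K v)).integratedOperator (hu v) (hc v) (μ v) (ξ v) ≠ 0) :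
    ∃ y : H, S.noncommProd
      (fun v => (σ.restrict (GLn.toAdelic n K v)).integratedOperator (hu v) (hc v) (μ v) (ξ v)) comm y ≠ 0 := by
  by_contra h
  push Not at h
  exact GLn.noncommProd_integratedOperator_toAdelic_ne_zero σ hσ hu hc μ ξ S hS comm h0
    (ContinuousLinearMap.ext h)

end GLn

end Literature.NumberTheory.Automorphic
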